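import Literature.NumberTheory.GaloisCohomology.Howard2004.DVRLevelRaisingInjectiveProofs
import Literature.NumberTheory.GaloisCohomology.Howard2004.TowerMorphism
import Literature.NumberTheory.GaloisCohomology.Howard2004.QuotCartesianReductionProofs
import Literature.NumberTheory.GaloisRepresentations.PPrimaryDevissage
import Literature.NumberTheory.GaloisRepresentations.UnramifiedSubgroupMapSurjective
import Literature.NumberTheory.GaloisRepresentations.UnramifiedClassesInertia
import HarnessLib

/-!
# Howard 2004, Lemma 1.3.3 on a `DVRSetting` — the levels `(k, k+1)`: `H¹(K, inc_k)` identifies `H¹_F(K, T^{(k)})`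
# with the `𝔪^{e_k}`-torsion of `H¹_F(K, T^{(k+1)})` (torsion control + the cartesian identity; theorems only)

Topic `NumberTheory/GaloisCohomology/Howard2004` (sequel to `DVRLevelRaisingInjectiveProofs`, which proved the
injectivity of `H¹(K, inc_k)` and `H¹(inc_k)(H¹_F(K, T^{(k)})) ⊆ H¹_F(K, T^{(k+1)})`).  THEOREMS ONLY: no definition,
no named fact, no instance, no notation, no `sorry`.

WHY (INPUTS row G87 = `Howard2004.thm161_dvrKolyvaginBound` = Howard Thm. 1.6.1; stub `stub_h161` of the μ-crux
stmt-BirchSwinnertonDyer-22642, binder `h161` of crux 23055's print-leaf census; cell `pub/bsd-print-x9`, seat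
`bsd-line-x10b-p1-w2` g14).  Conclusion (ii) of Thm. 1.6.1, `H¹_F(K, A) ≅ 𝒟 ⊕ M ⊕ M`, is read in print off
«`H¹_F(K, A)[𝔪^k] ≅ H¹_F(K, T^{(k)}) ≅ R/𝔪^k ⊕ M^{(k)} ⊕ M^{(k)}`» (arXiv:1202.6340 p. 12 L40–44): the CONTROL statement
of Lemma 1.3.3 (= Mazur–Rubin, Lemma 3.5.4) in the tower.  This file proves it for one step of the tower, on a
`DVRSetting` satisfying H.0–H.5, in the tree's currency (`AdicTower.inc/incLoc/incH1`, `SelmerStructure.selmerGroup`):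

* §1 (generic) `cohomologyMap_subtype_injective` — `H¹(F, W) ↪ H¹(F, M)` for a stable `W ≤ M` with `(M/W)^{Γ} = 0`;
* §2 (global) `exists_eq_pow_smul_of_forall` (no fixed vector mod `π^n T^{(j)}`, `n ≤ e_j`),
  `cohomologyMap_subtype_pow_smul_injective` (`H¹(K, π^nT^{(j)}) ↪ H¹(K, T^{(j)})`), and **(Z)
  `exists_incH1_eq_of_scalarMapH1_pow_eq_zero`**: `π^{e_k} c = 0 ⇒ c ∈ im H¹(K, inc_k)` (the short exact sequence
  `0 → T^{(k)} → T^{(k+1)} →(π^{e_k}·) π^{e_k}T^{(k+1)} → 0` as an `IsSES` + `exists_cohomologyMap_eq_of_cohomologyMap_eq_zero`);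
* §3 (local, the cartesian identity `F_{k,v} = H¹(K_v, inc_k)⁻¹ F_{k+1,v}`) **(C1) `comap_incLoc_cond_eq_of_mem`** at
  `v ∈ Σ(F)` from H.3 (`IsCartesianOnQuotAt` for the presentations `red_k`, `id` of `Quot(T^{(k+1)})` and the morphism
  `inc_k`, `T^{(k)}` being an `R_{k+1}`-module through `redR_k`), **(C2) `comap_incLoc_cond_eq_of_not_mem`** at finite
  `v ∉ Σ(F)` («unramified cartesian»: both levels unramified, classes unramified iff cocycles vanish on inertia),
  (C) `comap_incLoc_cond_eq` at every place, and **`incH1_mem_selmerGroup_iff`** (Selmer descent along `inc_k`);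
* §4 **`exists_mem_selmerGroup_incH1_eq_iff`** — the one-step Lemma 1.3.3:
  `(∃ c' ∈ H¹_F(K, T^{(k)}), H¹(inc_k) c' = c) ↔ c ∈ H¹_F(K, T^{(k+1)}) ∧ π^{e_k} c = 0`.

Print: Howard, Compositio Math. 140 (2004) = arXiv:1202.6340, Lemma 1.3.3 (arXiv 2.3.3, p. 7 L152–160: «the maps
`T/𝔪^iT → T[𝔪^i] → T` induce isomorphisms `H¹_F(K, T/𝔪^iT) → H¹_F(K, T[𝔪^i]) → H¹_F(K, T)[𝔪^i]`», proof = «Remark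
(cartesian identifications) and Lemma 3.5.4 of [MR04]»), H.3 (p. 7 L65–67) and «H.3 implies that `F` is cartesian on
`Quot(T)` at every place by Lemma (unramified cartesian)» (p. 7 L116–118); used at p. 12 L36–46.  HONEST FRAMING:
`thm161_dvrKolyvaginBound` is NOT proved (Thm. 1.4.2/Prop. 1.5.5, Lemma 1.6.4, conclusion (ii)'s algebra and the glue
remain); no summit statement is proved; the Birch–Swinnerton-Dyer conjecture is not proved by any of this.
References: [Howard2004HeegnerKolyvagin] Lemma 1.3.3, H.3, Def. 1.1.2–1.1.3, 1.1.10, §1.6; [MazurRubinMemoirs2004]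
Lemma 1.1.9, Lemma 3.5.4; [SerreGaloisCohomology1997] I §2.2; [MilneADT2006] I §2 (unramified cohomology).
-/

set_option autoImplicit false

noncomputable section

open Function NumberField IsDedekindDomain Field
open scoped NumberField ContRepresentation Pointwise

namespace Literature.NumberTheory.GaloisCohomology.Howard2004

open CategoryTheory
open Literature.NumberTheory.GaloisRepresentations
open Literature.NumberTheory.GaloisRepresentations.DiscreteGaloisModule
open Literature.NumberTheory.GaloisCohomology.Howard2004.LevelRaising

set_option allowUnsafeReducibility true in
attribute [local reducible] CategoryTheory.Functor.mapHomologicalComplex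

/-! ## §1 Generic: `H¹` of the inclusion of a stable subgroup with invariant-free quotient is injective -/

section Sub

variable {F : Type} [Field F] {M : Type} [AddCommGroup M] [TopologicalSpace M] [DiscreteTopology M]

/-- **`H¹(F, W) → H¹(F, M)` is injective for a `Γ_F`-stable subgroup `W ≤ M` with `(M/W)^{Γ_F} = 0`** (long exact
sequence of `0 → W → M → M/W → 0`, tree `isSES_subtype_mkQ`, in degrees `0 → 1`). [cite: SerreGaloisCohomology1997, I §2.2] -/
theorem cohomologyMap_subtype_injective [CompactSpace (absoluteGaloisGroup F)] (τ : DiscreteGaloisModule F M)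
    (W : Submodule ℤ M) (hW : ∀ g, W ≤ W.comap (τ g))
    (hfix : ∀ z : M, (∀ g : absoluteGaloisGroup F, τ g z - z ∈ W) → z ∈ W) :
    Function.Injective (ContinuousRep.cohomologyMap (τ.subrepresentation W hW) τ W.subtype.toAddMonoidHom
      continuous_of_discreteTopology (fun _ _ => rfl) 1) := by
  refine (injective_iff_map_eq_zero _).2 fun c hc => ?_
  have hSES := isSES_subtype_mkQ τ W hW
  have h0 : Subsingleton (continuousCohomology 0 (τ.quotient W hW).toTopRep) :=
    subsingleton_continuousCohomology_zero_of_forall_eq_zero _ fun q hq => by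
      induction q using Submodule.Quotient.induction_on with
      | _ z => exact (Submodule.Quotient.mk_eq_zero W).2 (hfix z fun g => (Submodule.Quotient.eq W).1 (hq g))
  have hc' : cohomologyMap (subtypeHom τ W hW) 1 c = 0 := hc
  exact hSES.cohomologyMap_one_eq_zero_imp h0 c hc'

end Sub

/-! ## §2 (Z) Torsion control on `H¹(K, ·)` -/

namespace DVRSetting

variable {p : ℕ} [Fact p.Prime] {K : Type} [Field K] [NumberField K]
  {R : Type} [CommRing R] [IsDomain R] [IsDiscreteValuationRing R] [Algebra ℤ_[p] R]
  {N : ℕ → Type} [∀ k, AddCommGroup (N k)] [∀ k, TopologicalSpace (N k)]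
  [∀ k, DiscreteTopology (N k)] [∀ k, Module R (N k)]
  {Rk : ℕ → Type} [∀ k, CommRing (Rk k)] [∀ k, IsLocalRing (Rk k)] [∀ k, TopologicalSpace (Rk k)]
  [∀ k, DiscreteTopology (Rk k)] [∀ k, Algebra ℤ_[p] (Rk k)] [∀ k, Algebra R (Rk k)]
  [∀ k, Module (Rk k) (N k)] [∀ k, IsScalarTower R (Rk k) (N k)]
  {Nbar : Type} [AddCommGroup Nbar] [TopologicalSpace Nbar] [DiscreteTopology Nbar]
  [∀ k, Module (Rk k) Nbar]
  {Nq : ℕ → Finset (HeightOneSpectrum (𝓞 K)) → Type} [∀ k n, AddCommGroup (Nq k n)]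
  [∀ k n, TopologicalSpace (Nq k n)] [∀ k n, DiscreteTopology (Nq k n)]
  [∀ k n, Module (Rk k) (Nq k n)] [∀ k n, Module R (Nq k n)]
  [∀ k n, IsScalarTower R (Rk k) (Nq k n)]

/-- **No `Γ_K`-fixed vector modulo `π^n T^{(j)}`** (`n ≤ e_j`): `σ z ≡ z (mod π^n)` for all `σ` forces `z ∈ π^n T^{(j)}`
(dévissage `LevelRaising.exists_eq_pow_smul_of_forall_sub_eq_pow_smul` from the residual case `ρbar_fixed_eq_zero`). [cite: Howard2004HeegnerKolyvagin, Lemma 1.3.3 and §1.6 (arXiv p. 7 L152–160, p. 12 L36–46)] -/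
theorem exists_eq_pow_smul_of_forall (S : DVRSetting p K R N Rk Nbar Nq) (hy : S.SatisfiesH) (j : ℕ)
    {n : ℕ} (hn : n ≤ S.e j) (z : N j)
    (hz : ∀ σ : absoluteGaloisGroup K, ∃ w, S.T.ρ j σ z - z = S.π ^ n • w) : ∃ y, z = S.π ^ n • y :=
  exists_eq_pow_smul_of_forall_sub_eq_pow_smul S.π (fun σ x => S.T.ρ j σ x)
    (fun σ r v => S.T.hlin j σ r v) (S.exists_eq_smul_of_forall_sub_eq_smul hy j)
    (S.e j) (fun _ hi v hv => S.exists_eq_smul_of_pow_smul_eq_zero hy j hi v hv) n hn z hz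

/-- `π^n T^{(j)}` is a `Γ_K`-stable subgroup of `T^{(j)}` (the action is `R`-linear). [cite: Howard2004HeegnerKolyvagin, Lemma 1.3.3 and §1.6 (arXiv p. 7 L152–160, p. 12 L36–46)] -/
theorem pow_smul_top_le_comap (S : DVRSetting p K R N Rk Nbar Nq) (j n : ℕ) (g : absoluteGaloisGroup K) :
    ((S.π ^ n) • (⊤ : Submodule R (N j))).restrictScalars ℤ ≤
      (((S.π ^ n) • (⊤ : Submodule R (N j))).restrictScalars ℤ).comap (S.T.ρ j g) := by
  intro z hz
  obtain ⟨w, -, rfl⟩ := (Submodule.mem_smul_pointwise_iff_exists _ _ _).1 hz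
  rw [Submodule.mem_comap]
  change S.T.ρ j g (S.π ^ n • w) ∈ _
  rw [S.T.hlin j g]
  exact Submodule.smul_mem_pointwise_smul _ _ ⊤ Submodule.mem_top

/-- **`H¹(K, π^n T^{(j)}) → H¹(K, T^{(j)})` is injective** for `n ≤ e_j`: the quotient `T^{(j)}/π^n T^{(j)}` has no
`Γ_K`-fixed vector (`exists_eq_pow_smul_of_forall`). [cite: Howard2004HeegnerKolyvagin, Lemma 1.3.3 and §1.6 (arXiv p. 7 L152–160, p. 12 L36–46)] [cite: SerreGaloisCohomology1997, I §2.2] -/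
theorem cohomologyMap_subtype_pow_smul_injective (S : DVRSetting p K R N Rk Nbar Nq) (hy : S.SatisfiesH)
    (j : ℕ) {n : ℕ} (hn : n ≤ S.e j) :
    Function.Injective (ContinuousRep.cohomologyMap
      ((S.T.ρ j).subrepresentation _ (S.pow_smul_top_le_comap j n)) (S.T.ρ j)
      (((S.π ^ n) • (⊤ : Submodule R (N j))).restrictScalars ℤ).subtype.toAddMonoidHom
      continuous_of_discreteTopology (fun _ _ => rfl) 1) := by
  refine cohomologyMap_subtype_injective (S.T.ρ j) _ (S.pow_smul_top_le_comap j n) fun z hz => ?_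
  obtain ⟨y, rfl⟩ := S.exists_eq_pow_smul_of_forall hy j hn z fun σ => by
    obtain ⟨w, -, hw⟩ := (Submodule.mem_smul_pointwise_iff_exists _ _ _).1 (hz σ)
    exact ⟨w, hw.symm⟩
  exact Submodule.smul_mem_pointwise_smul _ _ ⊤ Submodule.mem_top

/-- **(Z) Torsion control on `H¹(K, ·)`: a class of `H¹(K, T^{(k+1)})` killed by `π^{e_k}` is in the image of
`H¹(K, inc_k)`.**  The sequence `0 → T^{(k)} →(inc_k) T^{(k+1)} →(π^{e_k}·) π^{e_k}T^{(k+1)} → 0` is short exact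
(exact tower + H.0: `ker (π^{e_k}·) = π^{e_{k+1}-e_k} T^{(k+1)} = im (inc_k)`), so by the long exact sequence a class
killed by `H¹(π^{e_k}· : T^{(k+1)} → π^{e_k}T^{(k+1)})` comes from `H¹(K, T^{(k)})`; and `H¹(π^{e_k}·)c = 0` as soon as
`π^{e_k} c = 0` because `H¹(K, π^{e_k}T^{(k+1)}) → H¹(K, T^{(k+1)})` is injective
(`cohomologyMap_subtype_pow_smul_injective`) and the composite is the scalar `π^{e_k}` on `H¹`
(`cohomologyMap_one_comm_sq`, `cohomologyMap_smul_eq_scalarMapH1`).  The global half of Howard's Lemma 1.3.3 =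
Mazur–Rubin Lemma 3.5.4 for the pair of levels `(k, k+1)`. [cite: Howard2004HeegnerKolyvagin, Lemma 1.3.3 and §1.6 (arXiv p. 7 L152–160, p. 12 L36–46)] [cite: MazurRubinMemoirs2004, Lemma 3.5.4] [cite: SerreGaloisCohomology1997, I §2.2] -/
theorem exists_incH1_eq_of_scalarMapH1_pow_eq_zero (S : DVRSetting p K R N Rk Nbar Nq) (hy : S.SatisfiesH)
    (hπm : S.π ∈ IsLocalRing.maximalIdeal R) (hle : ∀ k, S.e k ≤ S.e (k + 1)) (k : ℕ)
    (c : galoisCohomology (S.T.ρ (k + 1)) 1)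
    (hc : galoisCohomology.scalarMapH1 (S.T.ρ (k + 1)) (S.T.hlin (k + 1)) (S.π ^ S.e k) c = 0) :
    ∃ c' : galoisCohomology (S.T.ρ k) 1, S.T.incH1 S.π S.e hy.killed hy.ker_red hπm hle k c' = c := by
  haveI := (hy.h0 (k + 1)).1
  -- the submodule `π^{e_k} T^{(k+1)}` and the corestricted multiplication
  set W : Submodule ℤ (N (k + 1)) := ((S.π ^ S.e k) • (⊤ : Submodule R (N (k + 1)))).restrictScalars ℤ
  have hW : ∀ g, W ≤ W.comap (S.T.ρ (k + 1) g) := S.pow_smul_top_le_comap (k + 1) (S.e k)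
  have hmemW : ∀ z : N (k + 1), S.π ^ S.e k • z ∈ W := fun z =>
    Submodule.smul_mem_pointwise_smul _ _ ⊤ Submodule.mem_top
  let μ : N (k + 1) →+ ↥W :=
    { toFun := fun z => ⟨S.π ^ S.e k • z, hmemW z⟩
      map_zero' := Subtype.ext (smul_zero _)
      map_add' := fun x y => Subtype.ext (smul_add _ _ _) }
  have hμ : ∀ (g : absoluteGaloisGroup K) (z : N (k + 1)),
      μ (S.T.ρ (k + 1) g z) = (S.T.ρ (k + 1)).subrepresentation W hW g (μ z) := fun g z =>
    Subtype.ext (by change S.π ^ S.e k • S.T.ρ (k + 1) g z = S.T.ρ (k + 1) g (S.π ^ S.e k • z)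
                    rw [S.T.hlin (k + 1) g])
  let ι := AdicTower.inc S.T S.π S.e hy.killed hy.ker_red hπm hle k
  let f : (S.T.ρ k).toTopRep ⟶ (S.T.ρ (k + 1)).toTopRep :=
    TopRep.ofHom ⟨⟨ι.toAddMonoidHom.toIntLinearMap, continuous_of_discreteTopology⟩,
      fun g => ContinuousLinearMap.ext fun x => AdicTower.inc_equivariant S.T S.π S.e hy.killed hy.ker_red hπm hle k g x⟩
  let gμ : (S.T.ρ (k + 1)).toTopRep ⟶ ((S.T.ρ (k + 1)).subrepresentation W hW).toTopRep :=
    TopRep.ofHom ⟨⟨μ.toIntLinearMap, continuous_of_discreteTopology⟩,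
      fun g => ContinuousLinearMap.ext fun x => hμ g x⟩
  have hSES : IsSES f gμ :=
    { comp_eq_zero := by
        ext x
        obtain ⟨w, rfl⟩ := S.T.red_surjective k x
        change S.π ^ S.e k • ι (S.T.red k w) = 0
        rw [AdicTower.inc_red, smul_smul, ← pow_add, Nat.add_sub_cancel' (hle k)]
        exact hy.killed (k + 1) _ (Ideal.pow_mem_pow hπm _) w
      injective := fun a b h => S.inc_injective hy hπm hle k h
      exact_mid := fun z hz => by
        have hz' : S.π ^ S.e k • z = 0 := congrArg Subtype.val hz
        obtain ⟨z', rfl⟩ := exists_eq_pow_smul_of_pow_smul_eq_zero S.π (S.π_ne_zero hy) (S.e (k + 1))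
          (hy.algebraMap_surjective (k + 1)) (S.ker_algebraMap_le hy (k + 1)) (hle k) z hz'
        exact (AdicTower.mem_range_inc_iff S.T S.π S.e hy.killed hy.ker_red hπm hle k _).2 ⟨z', rfl⟩
      surjective := fun w => by
        obtain ⟨z, -, hz⟩ := (Submodule.mem_smul_pointwise_iff_exists _ _ _).1 w.2
        exact ⟨z, Subtype.ext hz⟩ }
  -- `H¹(subtype) ∘ H¹(μ) = H¹(π^{e_k} •) = 0` on `c`, and `H¹(subtype)` is injective
  have hsq := cohomologyMap_one_comm_sq (S.T.ρ (k + 1)) ((S.T.ρ (k + 1)).subrepresentation W hW)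
    (S.T.ρ (k + 1)) (S.T.ρ (k + 1)) μ hμ W.subtype.toAddMonoidHom (fun _ _ => rfl)
    (AddMonoidHom.id _) (fun _ _ => rfl) (DistribSMul.toAddMonoidHom (N (k + 1)) (S.π ^ S.e k))
    (fun g y => (S.T.hlin (k + 1) g (S.π ^ S.e k) y).symm) (fun _ => rfl) c
  rw [cohomologyMap_id_apply, cohomologyMap_smul_eq_scalarMapH1 _ (S.T.hlin (k + 1)), hc] at hsq
  have hμc : cohomologyMap gμ 1 c = 0 :=
    S.cohomologyMap_subtype_pow_smul_injective hy (k + 1) (hle k) (hsq.trans (map_zero _).symm)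
  obtain ⟨a, ha⟩ := hSES.exists_cohomologyMap_eq_of_cohomologyMap_eq_zero 1 c hμc
  exact ⟨a, ha⟩

/-! ## §3 (C) The one-step cartesian identity and Selmer descent -/

/-- **(C1) The one-step cartesian identity at `v ∈ Σ(F)`: `F_{k,v} = H¹(K_v, inc_k)⁻¹(F_{k+1,v})`**, from H.3 on
`T^{(k+1)}` (`SatisfiesH.h3`: the condition is cartesian on `Quot(T^{(k+1)})` over `R_{k+1}`) applied to the
presentations `red_k : T^{(k+1)} ↠ T^{(k)} = T^{(k+1)}/𝔪^{e_k}` (kernel `(π̄^{e_k})·T^{(k+1)}`, exact tower; `T^{(k)}` an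
`R_{k+1}`-module through `redR_k`) and `id : T^{(k+1)} ↠ T^{(k+1)}/0`, and the injective `Quot`-morphism `inc_k`
(`inc_k ∘ red_k = π̄^{e_{k+1}-e_k}`, Def. 1.1.3): the propagated conditions are `F_{k,v}` (`cond_red`) and `F_{k+1,v}`. [cite: Howard2004HeegnerKolyvagin, H.3, Def. 1.1.2–1.1.3 and Lemma 1.3.3 (arXiv p. 5 L88–99, p. 7 L65–67 and L152–160)] -/
theorem comap_incLoc_cond_eq_of_mem (S : DVRSetting p K R N Rk Nbar Nq) (hy : S.SatisfiesH)
    (hπm : S.π ∈ IsLocalRing.maximalIdeal R) (hle : ∀ k, S.e k ≤ S.e (k + 1)) (k : ℕ) (v : Place K)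
    (hv : v ∈ S.Sigma) :
    ((S.t (k + 1)).cond v).comap (AdicTower.incLoc S.T S.π S.e hy.killed hy.ker_red hπm hle k v) =
      (S.t k).cond v := by
  -- the level ring `R_{k+1}` acts on `T^{(k)}` through `redR`
  letI instRk : Module (Rk (k + 1)) (N k) := Module.compHom (N k) (S.redR k)
  have hsmulk : ∀ (r : R) (x : N k), (algebraMap R (Rk (k + 1)) r) • x = r • x := fun r x => by
    change S.redR k (algebraMap R (Rk (k + 1)) r) • x = r • x
    rw [hy.redR_comp, algebraMap_smul]
  -- the presentation `T^{(k+1)} ↠ T^{(k)}` and the morphism `inc_k`, `R_{k+1}`-linearly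
  let πI : N (k + 1) →ₗ[Rk (k + 1)] N k :=
    { toFun := S.T.red k
      map_add' := map_add _
      map_smul' := fun a y => by
        obtain ⟨r, rfl⟩ := hy.algebraMap_surjective (k + 1) a
        rw [RingHom.id_apply, hsmulk, algebraMap_smul, map_smul] }
  let f : N k →ₗ[Rk (k + 1)] N (k + 1) :=
    { toFun := AdicTower.inc S.T S.π S.e hy.killed hy.ker_red hπm hle k
      map_add' := map_add _
      map_smul' := fun a x => by
        obtain ⟨r, rfl⟩ := hy.algebraMap_surjective (k + 1) a
        rw [RingHom.id_apply, hsmulk, map_smul, algebraMap_smul] }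
  set ϖ : Rk (k + 1) := algebraMap R (Rk (k + 1)) S.π with hϖ
  have hI : IsQuotientBy (S.T.ρ (k + 1)) (Ideal.span {ϖ ^ S.e k}) (S.T.ρ k) πI :=
    { surjective := S.T.red_surjective k
      ker_eq := by
        ext z
        rw [LinearMap.mem_ker, Submodule.ideal_span_singleton_smul, Submodule.mem_smul_pointwise_iff_exists]
        change S.T.red k z = 0 ↔ _
        rw [← LinearMap.mem_ker, hy.ker_red k, hy.unif, Ideal.span_singleton_pow,
          Submodule.ideal_span_singleton_smul, Submodule.mem_smul_pointwise_iff_exists]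
        constructor
        · rintro ⟨w, -, rfl⟩
          exact ⟨w, Submodule.mem_top, by rw [hϖ, ← map_pow, algebraMap_smul]⟩
        · rintro ⟨w, -, rfl⟩
          exact ⟨w, Submodule.mem_top, by rw [hϖ, ← map_pow, algebraMap_smul]⟩
      equivariant := S.T.red_equivariant k }
  have hJ : IsQuotientBy (S.T.ρ (k + 1)) (⊥ : Ideal (Rk (k + 1))) (S.T.ρ (k + 1)) LinearMap.id :=
    { surjective := Function.surjective_id
      ker_eq := by rw [LinearMap.ker_id, Submodule.bot_smul]
      equivariant := fun _ _ => rfl }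
  have hzero : algebraMap R (Rk (k + 1)) (S.π ^ S.e (k + 1)) = 0 :=
    (RingHom.mem_ker).1 (by rw [hy.ker_algebraMap]; exact Ideal.pow_mem_pow hπm _)
  have hf : IsQuotMorphism (S.T.ρ (k + 1)) (Ideal.span {ϖ ^ S.e k}) ⊥ (S.T.ρ k) πI (S.T.ρ (k + 1))
      LinearMap.id (ϖ ^ (S.e (k + 1) - S.e k)) f :=
    { smul_le := fun x hx => by
        obtain ⟨a, rfl⟩ := Ideal.mem_span_singleton'.1 hx
        rw [Ideal.mem_bot, mul_left_comm, ← pow_add, Nat.sub_add_cancel (hle k), hϖ, ← map_pow, hzero,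
          mul_zero]
      comp_eq := fun m => by
        change AdicTower.inc S.T S.π S.e hy.killed hy.ker_red hπm hle k (S.T.red k m) = _ • m
        rw [AdicTower.inc_red, hϖ, ← map_pow, algebraMap_smul]
      equivariant := fun σ x => AdicTower.inc_equivariant S.T S.π S.e hy.killed hy.ker_red hπm hle k σ x }
  have hv' : v ∈ (S.t (k + 1)).Sigma := by rwa [hy.Sigma_eq]
  have hcart := hy.h3 (k + 1) v hv' _ _ (N k) (N (k + 1)) (S.T.ρ k) πI (S.T.ρ (k + 1)) LinearMap.id hI hJ
    _ f hf (S.inc_injective hy hπm hle k)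
  have h1 : hI.propagate v ((S.t (k + 1)).cond v) = (S.t k).cond v := hy.cond_red k v
  have h2 : hJ.propagate v ((S.t (k + 1)).cond v) = (S.t (k + 1)).cond v := by
    ext x
    constructor
    · rintro ⟨y, hy', rfl⟩
      rwa [show hJ.localCohomologyMap v 1 y = y from cohomologyMap_id_apply _ y]
    · intro hx
      exact ⟨x, hx, cohomologyMap_id_apply _ x⟩
  rw [h1, h2] at hcart
  exact hcart.symm

/-- **(C2) The one-step cartesian identity at a finite `v ∉ Σ(F)` («unramified cartesian»)**:
`H¹_ur(K_v, T^{(k)}) = H¹(K_v, inc_k)⁻¹(H¹_ur(K_v, T^{(k+1)}))`.  Off `Σ(F)` both level conditions are the unramified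
ones and both levels are unramified at `v` (`IsHowardSelmerStructure`), so the inertia group `I_{K_v}` acts trivially
(`GaloisRep.toLocal_apply_eq_self_of_isUnramifiedAt`) and a class is unramified iff a representative cocycle VANISHES
on `I_{K_v}` (`oneCocycleClass_mem_unramifiedSubgroup_iff_forall_eq_zero`); `inc_k` is injective. [cite: Howard2004HeegnerKolyvagin, Def. 1.1.10 and §1.3 «Lemma (unramified cartesian)» (arXiv p. 6 L14–24, p. 7 L116–118)] [cite: MazurRubinMemoirs2004, Lemma 1.1.9 and Lemma 3.5.4] -/
theorem comap_incLoc_cond_eq_of_not_mem (S : DVRSetting p K R N Rk Nbar Nq) (hy : S.SatisfiesH)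
    (hπm : S.π ∈ IsLocalRing.maximalIdeal R) (hle : ∀ k, S.e k ≤ S.e (k + 1)) (k : ℕ)
    (v : HeightOneSpectrum (𝓞 K)) (hv : (Sum.inr v : Place K) ∉ S.Sigma) :
    ((S.t (k + 1)).cond (Sum.inr v)).comap
        (AdicTower.incLoc S.T S.π S.e hy.killed hy.ker_red hπm hle k (Sum.inr v)) =
      (S.t k).cond (Sum.inr v) := by
  have hvk : (Sum.inr v : Place K) ∉ (S.t k).Sigma := by rwa [hy.Sigma_eq]
  have hvk1 : (Sum.inr v : Place K) ∉ (S.t (k + 1)).Sigma := by rwa [hy.Sigma_eq]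
  have hur : GaloisRep.IsUnramifiedAt v (S.T.ρ k) :=
    not_not.1 fun h => hvk ((S.t k).isHoward.mem_of_ramified v h)
  have hur1 : GaloisRep.IsUnramifiedAt v (S.T.ρ (k + 1)) :=
    not_not.1 fun h => hvk1 ((S.t (k + 1)).isHoward.mem_of_ramified v h)
  rw [(S.t k).isHoward.isUnramifiedOutside.2 v hvk, (S.t (k + 1)).isHoward.isUnramifiedOutside.2 v hvk1]
  have hI : ∀ τ ∈ absInertia (v.adicCompletion K), ∀ w : N k, GaloisRep.toLocal v (S.T.ρ k) τ w = w :=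
    fun _ hτ w => GaloisRep.toLocal_apply_eq_self_of_isUnramifiedAt _ hur hτ w
  have hI1 : ∀ τ ∈ absInertia (v.adicCompletion K), ∀ w : N (k + 1),
      GaloisRep.toLocal v (S.T.ρ (k + 1)) τ w = w :=
    fun _ hτ w => GaloisRep.toLocal_apply_eq_self_of_isUnramifiedAt _ hur1 hτ w
  ext c
  obtain ⟨z, rfl⟩ := oneCocycleClass_surjective _ c
  rw [AddSubgroup.mem_comap]
  change ContinuousRep.cohomologyMap ((S.T.ρ k).toLocal (Sum.inr v)) ((S.T.ρ (k + 1)).toLocal (Sum.inr v))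
      (AdicTower.inc S.T S.π S.e hy.killed hy.ker_red hπm hle k).toAddMonoidHom continuous_of_discreteTopology
      (fun _ x => AdicTower.inc_equivariant S.T S.π S.e hy.killed hy.ker_red hπm hle k _ x) 1
      (oneCocycleClass _ z) ∈ _ ↔ _
  rw [cohomologyMap_one_oneCocycleClass]
  refine (DiscreteGaloisModule.oneCocycleClass_mem_unramifiedSubgroup_iff_forall_eq_zero
    (GaloisRep.toLocal v (S.T.ρ (k + 1))) hI1 _).trans
    (Iff.trans (forall₂_congr fun τ _ => ?_)
      (DiscreteGaloisModule.oneCocycleClass_mem_unramifiedSubgroup_iff_forall_eq_zero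
        (GaloisRep.toLocal v (S.T.ρ k)) hI z).symm)
  change AdicTower.inc S.T S.π S.e hy.killed hy.ker_red hπm hle k (z.1 τ) = 0 ↔ z.1 τ = 0
  exact map_eq_zero_iff _ (S.inc_injective hy hπm hle k)

/-- **(C) The one-step cartesian identity at EVERY place: `F_{k,v} = H¹(K_v, inc_k)⁻¹(F_{k+1,v})`** on a `DVRSetting`
with H.0–H.5 (`Σ(F)` contains the archimedean places; (C1) on `Σ(F)`, (C2) off it). [cite: Howard2004HeegnerKolyvagin, H.3, Def. 1.1.2–1.1.3 and Lemma 1.3.3 (arXiv p. 5 L88–99, p. 7 L65–67 and L152–160)] -/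
theorem comap_incLoc_cond_eq (S : DVRSetting p K R N Rk Nbar Nq) (hy : S.SatisfiesH)
    (hπm : S.π ∈ IsLocalRing.maximalIdeal R) (hle : ∀ k, S.e k ≤ S.e (k + 1)) (k : ℕ) (v : Place K) :
    ((S.t (k + 1)).cond v).comap (AdicTower.incLoc S.T S.π S.e hy.killed hy.ker_red hπm hle k v) =
      (S.t k).cond v := by
  by_cases hv : v ∈ S.Sigma
  · exact S.comap_incLoc_cond_eq_of_mem hy hπm hle k v hv
  · rcases v with w | v
    · exact absurd ((hy.Sigma_eq k) ▸ (S.t k).isHoward.isUnramifiedOutside.1 w) hv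
    · exact S.comap_incLoc_cond_eq_of_not_mem hy hπm hle k v hv

/-- **Selmer descent along `inc_k`: `H¹(K, inc_k) c ∈ H¹_F(K, T^{(k+1)}) ↔ c ∈ H¹_F(K, T^{(k)})`** — localisation
commutes with `H¹(inc_k)` (`AdicTower.localization_incH1`) and (C).  With `DVRSetting.incH1_injective` and (Z) this is
Howard's Lemma 1.3.3 for the levels `(k, k+1)`: `H¹(K, inc_k) : H¹_F(K, T^{(k)}) ≅ H¹_F(K, T^{(k+1)})[𝔪^{e_k}]`
(`exists_mem_selmerGroup_incH1_eq_iff`). [cite: Howard2004HeegnerKolyvagin, Lemma 1.3.3 and §1.6 (arXiv p. 7 L152–160, p. 12 L36–46)] [cite: MazurRubinMemoirs2004, Lemma 3.5.4] -/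
theorem incH1_mem_selmerGroup_iff (S : DVRSetting p K R N Rk Nbar Nq) (hy : S.SatisfiesH)
    (hπm : S.π ∈ IsLocalRing.maximalIdeal R) (hle : ∀ k, S.e k ≤ S.e (k + 1)) (k : ℕ)
    (c : galoisCohomology (S.T.ρ k) 1) :
    S.T.incH1 S.π S.e hy.killed hy.ker_red hπm hle k c ∈ ((S.t (k + 1)).cond).selmerGroup ↔
      c ∈ ((S.t k).cond).selmerGroup := by
  simp only [SelmerStructure.mem_selmerGroup_iff, AdicTower.localization_incH1]
  refine forall_congr' fun v => ?_
  rw [← S.comap_incLoc_cond_eq hy hπm hle k v, AddSubgroup.mem_comap]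

/-! ## §4 Lemma 1.3.3 for the levels `(k, k+1)` -/

/-- **Howard 2004, Lemma 1.3.3 for the levels `(k, k+1)` of a `DVRSetting` with H.0–H.5 — `H¹(K, inc_k)` identifies
`H¹_F(K, T^{(k)})` with the `𝔪^{e_k}`-torsion of `H¹_F(K, T^{(k+1)})`**: a class `c ∈ H¹(K, T^{(k+1)})` is a SELMER class
killed by `π^{e_k}` iff `c = H¹(K, inc_k) c'` for a (unique, `DVRSetting.incH1_injective`) Selmer class
`c' ∈ H¹_F(K, T^{(k)})` — (Z) + Selmer descent (C); conversely `H¹(K, T^{(k)})` is killed by `π^{e_k}`.  Both printed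
inputs «Lemma 1.3.3» of the G87 reduction are now kernel theorems on a `DVRSetting`; the colimit reading
`H¹_F(K, A)[𝔪^{e_k}] = im H¹_F(K, T^{(k)})` (arXiv p. 12 L40–44) is the sequel.
[cite: Howard2004HeegnerKolyvagin, Lemma 1.3.3 and Thm. 1.6.1 proof (arXiv p. 7 L152–160, p. 12 L36–46)]
[cite: MazurRubinMemoirs2004, Lemma 3.5.4] -/
theorem exists_mem_selmerGroup_incH1_eq_iff (S : DVRSetting p K R N Rk Nbar Nq) (hy : S.SatisfiesH)
    (hπm : S.π ∈ IsLocalRing.maximalIdeal R) (hle : ∀ k, S.e k ≤ S.e (k + 1)) (k : ℕ)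
    (c : galoisCohomology (S.T.ρ (k + 1)) 1) :
    (∃ c' ∈ ((S.t k).cond).selmerGroup, S.T.incH1 S.π S.e hy.killed hy.ker_red hπm hle k c' = c) ↔
      c ∈ ((S.t (k + 1)).cond).selmerGroup ∧
        galoisCohomology.scalarMapH1 (S.T.ρ (k + 1)) (S.T.hlin (k + 1)) (S.π ^ S.e k) c = 0 := by
  constructor
  · rintro ⟨c', hc', rfl⟩
    refine ⟨(S.incH1_mem_selmerGroup_iff hy hπm hle k c').2 hc', ?_⟩
    have h0 : galoisCohomology.scalarMapH1 (S.T.ρ k) (S.T.hlin k) (S.π ^ S.e k) c' = 0 :=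
      galoisCohomology.smul_eq_zero_of_forall (S.T.ρ k) (S.T.hlin k) _
        (fun m => hy.killed k _ (Ideal.pow_mem_pow hπm _) m) c'
    rw [← AdicTower.incH1_scalarMapH1, h0, map_zero]
  · rintro ⟨hc, h0⟩
    obtain ⟨c', rfl⟩ := S.exists_incH1_eq_of_scalarMapH1_pow_eq_zero hy hπm hle k c h0
    exact ⟨c', (S.incH1_mem_selmerGroup_iff hy hπm hle k c').1 hc, rfl⟩

end DVRSetting

end Literature.NumberTheory.GaloisCohomology.Howard2004

end
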